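import Summits.ResolutionOfSingularities.ResolutionOfSingularities.Theorems.HilbertSamuelEliminationSigmaMaxModificationsCorridor3CPFrameLegality
import Literature.AlgebraicGeometry.Resolution.RegularCentreRsopPart
import Mathlib.RingTheory.Nakayama
import HarnessLib

/-!
# [OURS · L1 W4.2] D18 (i) ADAPT, algebraic core — a centre prime `Q ∋ h` of `R[X]` with regular quotient along which `h` is equimultiple
# contains `X − θ`: the centre is READ as `V(X − θ, 𝔮)` with `𝔮 = Q ∩ R` a regular prime of `R`
# (cell res-hironaka, LADDER-RESOLUTION rung L; slot W4.2, crux chain w42 `SigmaMaxModificationsCorridor3` stmt-ResolutionOfSingularities-19249;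
# `--supports stmt-ResolutionOfSingularities-19249 --as helper`; res-L1-w42-plan-1 RULING v3.14-42 (KG)(2) «(G8) → (G7) → hread_menu»; hand
# res-D-pv-060 (gen 8), on top of `…CPFrameLegality` (G7, p550623))

PURE COMMUTATIVE ALGEBRA, 0 `def`s, every declaration PROVED; OURS bookkeeping; NOT a statement of Hironaka's manuscript [Hironaka2017] nor of
[CossartJannsenSaito2020]/[CossartPiltant2019]. AI-written, weaker than expert review.

WHY. `…CPFrameLegality` turned the binder `hread` of `Moving.exists_isCPFrame_of_reaches` into «permissibility + an ADAPTED READING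
`(𝓘_{C,x_n})·B = ((u_T) + (X))/(h)`». This file is the algebra that PRODUCES the reading (CP 2019 Prop. 2.7 ¶1 «I(𝒴) = (Z, u_J)»): the
preimage `Q` in `R[X]` of the centre is a prime with `R[X]/Q` regular local, `h ∈ Q ⊆ 𝔐 = 𝔪_R R[X] + (X)`, and — by
`exists_mul_mem_pow_of_isNormallyFlat` (normal flatness) — `ord_Q h ≥ m = deg h`. THEN:

* `map_residue_eq_X_pow` — `δ > 0` (`coeff_i h ∈ 𝔪_R`, `i < m`) means `h ≡ X^m` modulo `𝔪_R`.
* **`exists_X_sub_C_mem_of_order`** — `X − θ ∈ Q` for some `θ ∈ 𝔪_R`. Proof: (i) the powers of `Q·R[X]_𝔐` are primary (regular quotient, tree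
  `mem_pow_of_mul_mem_pow_of_isRegularLocalRing_quotient`), so `s'·h ∈ Q^m` for some `s' ∉ 𝔐`, i.e. `s'(0) ∉ 𝔪_R`; (ii) modulo `𝔪_R`, in the PID
  `κ[X]`: the image of `Q` is `(X^a)` (it contains `X^m`), and `X^{am} ∣ s̄'·X^m` with `X ∤ s̄'` forces `a ≤ 1`, so `X ∈ Q + 𝔪_R R[X]`; (iii)
  Nakayama for the finite `R`-module `R[X]/Q`: `R → R[X]/Q` is onto, so `X ≡ θ`. No completeness of `R` is used.
* `eq_span_X_sub_C_sup_of_mem`, `exists_ringEquiv_quotient_comap_C_of_X_sub_C_mem`, **`exists_adapted_prime_of_order`** — then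
  `Q = (X − θ) + 𝔮·R[X]` with `𝔮 = Q ∩ R`, `R/𝔮 ≅ R[X]/Q` is regular local (so `𝔮` is generated by PART OF A REGULAR SYSTEM OF PARAMETERS of `R`,
  tree `exists_isRsopPart_span_range_eq`), packaged as one statement.

References: CP 2019 Prop. 2.5–2.7 (arXiv v1 pp. 13–14) [CossartPiltant2019]; CJS LNM 2270 Def. 3.1, Thm. 3.3 [CossartJannsenSaito2020];
Matsumura Thms. 2.2 (Nakayama), 14.2, 16.2 (ii), 19.5 [Matsumura1987].
-/

noncomputable section

set_option linter.dupNamespace false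

open IsLocalRing IsLocalization Polynomial
open Literature.RingTheory.HilbertSamuel Literature.AlgebraicGeometry.Resolution

universe u

namespace Summit.ResolutionOfSingularities.ResolutionOfSingularities.Theorems.SigmaMaxModificationsCorridor3.Helpers

section Read

variable {R : Type u} [CommRing R] [IsLocalRing R] {h : R[X]}

/-- `δ > 0`: a monic `h` of degree `m` with lower coefficients in `𝔪_R` reduces to `X^m` modulo `𝔪_R`. [folklore] -/
theorem map_residue_eq_X_pow (hmo : h.Monic) (hco : ∀ i < h.natDegree, h.coeff i ∈ maximalIdeal R) :
    h.map (residue R) = X ^ h.natDegree := by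
  ext n
  rw [coeff_map, coeff_X_pow]
  rcases lt_trichotomy n h.natDegree with hlt | rfl | hgt
  · rw [if_neg hlt.ne, (residue_eq_zero_iff _).mpr (hco n hlt)]
  · rw [if_pos rfl, hmo.coeff_natDegree, map_one]
  · rw [if_neg hgt.ne', coeff_eq_zero_of_natDegree_lt hgt, map_zero]

/-- `Q ⊆ 𝔐 = 𝔪_R R[X] + (X)` and `R[X]/Q` local: `𝔐` IS the preimage of the maximal ideal of `R[X]/Q`. [folklore] -/
theorem comap_mk_maximalIdeal_eq_of_le (Q : Ideal R[X]) [IsLocalRing (R[X] ⧸ Q)]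
    (hQ : Q ≤ (maximalIdeal R).map (C : R →+* R[X]) ⊔ Ideal.span {(X : R[X])}) :
    (maximalIdeal (R[X] ⧸ Q)).comap (Ideal.Quotient.mk Q) = (maximalIdeal R).map (C : R →+* R[X]) ⊔ Ideal.span {(X : R[X])} := by
  set M : Ideal R[X] := (maximalIdeal R).map (C : R →+* R[X]) ⊔ Ideal.span {(X : R[X])} with hM
  -- `M` is maximal: its complement consists of units modulo `M`… we use: `M ≠ ⊤` and `M.map mk` is a proper ideal containing `𝔪`'s preimage
  have hMtop : M ≠ ⊤ := by
    intro htop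
    have h1 : (1 : R[X]) ∈ M := htop ▸ Submodule.mem_top
    have h2 := Literature.AlgebraicGeometry.Resolution.Polynomial.coeff_zero_mem_of_mem_sup_span_X h1
    rw [coeff_one_zero] at h2
    exact (maximalIdeal.isMaximal R).ne_top (Ideal.eq_top_of_isUnit_mem _ h2 isUnit_one)
  -- every `g ∉ M` is a unit modulo `Q`: indeed `g(0) ∉ 𝔪_R`; but we argue through maximality of `M` instead
  have hMmax : M.IsMaximal := by
    rw [Ideal.isMaximal_iff]
    refine ⟨fun h1 => hMtop (Ideal.eq_top_of_isUnit_mem _ h1 isUnit_one), fun J g hMJ hgM hgJ => ?_⟩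
    -- `g(0)` is a unit of `R`, and `g ≡ C (g 0)` modulo `(X) ⊆ M ⊆ J`
    have hg0 : g.coeff 0 ∉ maximalIdeal R := coeff_zero_not_mem_of_not_mem_sup_span_X hgM
    have hunit : IsUnit (g.coeff 0) := of_not_not fun hu => hg0 ((mem_maximalIdeal _).mpr hu)
    obtain ⟨v, hv⟩ := hunit.exists_left_inv
    have hXJ : X * (g.divX * C v) ∈ J := J.mul_mem_right _ (hMJ (Ideal.mem_sup_right (Ideal.mem_span_singleton_self X)))
    have hgv : g * C v ∈ J := J.mul_mem_right _ hgJ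
    have key : (1 : R[X]) = g * C v - X * (g.divX * C v) := by
      have := X_mul_divX_add g
      calc (1 : R[X]) = C (v * g.coeff 0) := by rw [hv, map_one]
        _ = C (g.coeff 0) * C v := by rw [map_mul, mul_comm]
        _ = (X * g.divX + C (g.coeff 0)) * C v - X * (g.divX * C v) := by ring
        _ = g * C v - X * (g.divX * C v) := by rw [this]
    rw [key]
    exact J.sub_mem hgv hXJ
  -- `Q ⊆ M`, so `M/Q` is a proper ideal of the local ring `R[X]/Q`, hence inside its maximal ideal; maximality of `M` gives equality
  have hle : M ≤ (maximalIdeal (R[X] ⧸ Q)).comap (Ideal.Quotient.mk Q) := by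
    rw [← Ideal.map_le_iff_le_comap]
    refine IsLocalRing.le_maximalIdeal fun htop => hMtop ?_
    have h1 := congrArg (Ideal.comap (Ideal.Quotient.mk Q)) htop
    rw [Ideal.comap_map_of_surjective _ Ideal.Quotient.mk_surjective, Ideal.comap_top] at h1
    rw [← h1, show Ideal.comap (Ideal.Quotient.mk Q) ⊥ = RingHom.ker (Ideal.Quotient.mk Q) from rfl, Ideal.mk_ker]
    exact (sup_eq_left.mpr hQ).symm
  exact (hMmax.eq_of_le (Ideal.comap_ne_top _ (maximalIdeal.isMaximal _).ne_top) hle).symm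

end Read

section Order

variable {R : Type u} [CommRing R] [IsRegularLocalRing R] {h : R[X]}

/-- [OURS · L1 W4.2] **An equimultiple regular centre prime through a `δ > 0` hypersurface contains `X − θ`.** `R` regular local, `h ∈ R[X]`
monic of degree `m` with `coeff_i h ∈ 𝔪_R` (`i < m`), `Q` a prime of `R[X]` with `h ∈ Q ⊆ 𝔪_R R[X] + (X)`, `R[X]/Q` regular local, and
`s·h ∈ Q^m` for some `s ∉ Q` (`ord_Q h ≥ m`: the output of `exists_mul_mem_pow_of_isNormallyFlat`). Then `X − θ ∈ Q` for some `θ ∈ 𝔪_R`.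
[cite: CossartPiltant2019, Prop. 2.5–2.7 (arXiv v1 pp. 13–14)] [cite: Matsumura1987, Thm. 2.2 and Thm. 16.2 (ii)] -/
theorem exists_X_sub_C_mem_of_order (hmo : h.Monic) (hco : ∀ i < h.natDegree, h.coeff i ∈ maximalIdeal R)
    (Q : Ideal R[X]) [Q.IsPrime] (hhQ : h ∈ Q) (hQ : Q ≤ (maximalIdeal R).map (C : R →+* R[X]) ⊔ Ideal.span {(X : R[X])})
    [IsRegularLocalRing (R[X] ⧸ Q)] (hord : ∃ s ∉ Q, s * h ∈ Q ^ h.natDegree) :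
    ∃ θ ∈ maximalIdeal R, X - C θ ∈ Q := by
  set M : Ideal R[X] := (maximalIdeal R).map (C : R →+* R[X]) ⊔ Ideal.span {(X : R[X])} with hMdef
  set 𝔐 : Ideal R[X] := (maximalIdeal (R[X] ⧸ Q)).comap (Ideal.Quotient.mk Q) with h𝔐def
  have h𝔐M : 𝔐 = M := comap_mk_maximalIdeal_eq_of_le Q hQ
  haveI h𝔐p : 𝔐.IsPrime := Ideal.comap_isPrime _ _
  have hQ𝔐 : Q ≤ 𝔐 := fun g hg => by
    rw [h𝔐def, Ideal.mem_comap, Ideal.Quotient.eq_zero_iff_mem.mpr hg]; exact zero_mem _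
  -- (i) `S₁ = R[X]_𝔐` is regular local, `Q S₁` is a prime with regular quotient `≅ R[X]/Q`
  have hcomapC : 𝔐.comap C = maximalIdeal R := by
    refine ((maximalIdeal.isMaximal R).eq_of_le (Ideal.comap_ne_top _ h𝔐p.ne_top) fun r hr => ?_).symm
    rw [Ideal.mem_comap, h𝔐M]
    exact Ideal.mem_sup_left (Ideal.mem_map_of_mem _ hr)
  set S₁ := Localization.AtPrime 𝔐 with hS₁
  haveI hreg₁ : IsRegularLocalRing S₁ := Polynomial.isRegularLocalRing_localization_atPrime_of_comap_eq_maximalIdeal R 𝔐 hcomapC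
  have hdisj : Disjoint (𝔐.primeCompl : Set R[X]) (Q : Set R[X]) :=
    Set.disjoint_left.mpr fun g hg hgQ => hg (hQ𝔐 hgQ)
  set P₁ : Ideal S₁ := Q.map (algebraMap R[X] S₁) with hP₁
  haveI hP₁p : P₁.IsPrime := IsLocalization.isPrime_of_isPrime_disjoint 𝔐.primeCompl S₁ Q ‹Q.IsPrime› hdisj
  have hP₁c : P₁.comap (algebraMap R[X] S₁) = Q := by
    have h1 := IsLocalization.under_map_of_isPrime_disjoint 𝔐.primeCompl S₁ ‹Q.IsPrime› hdisj
    rwa [Ideal.under_def] at h1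
  haveI : IsLocalRing (R[X] ⧸ Q) := inferInstance
  obtain ⟨e, -⟩ := exists_ringEquiv_quotient_localization_of_isLocalRing (R := R[X]) Q
  haveI hregP₁ : IsRegularLocalRing (S₁ ⧸ P₁) := IsRegularLocalRing.of_ringEquiv e
  -- `h ∈ (Q S₁)^m`, hence `s' h ∈ Q^m` for some `s' ∉ 𝔐`
  obtain ⟨s, hsQ, hsh⟩ := hord
  have hs₁ : algebraMap R[X] S₁ s ∉ P₁ := fun hmem => hsQ (by rw [← hP₁c]; exact Ideal.mem_comap.mpr hmem)
  have hsh₁ : algebraMap R[X] S₁ s * algebraMap R[X] S₁ h ∈ P₁ ^ h.natDegree := by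
    rw [← map_mul, hP₁, ← Ideal.map_pow]
    exact Ideal.mem_map_of_mem _ hsh
  have hh₁ : algebraMap R[X] S₁ h ∈ P₁ ^ h.natDegree := mem_pow_of_mul_mem_pow_of_isRegularLocalRing_quotient hs₁ _ hsh₁
  rw [hP₁, ← Ideal.map_pow, IsLocalization.algebraMap_mem_map_algebraMap_iff 𝔐.primeCompl] at hh₁
  obtain ⟨s', hs'𝔐, hs'h⟩ := hh₁
  have hs'M : s' ∉ M := by rw [← h𝔐M]; exact hs'𝔐
  have hs'0 : s'.coeff 0 ∉ maximalIdeal R := coeff_zero_not_mem_of_not_mem_sup_span_X hs'M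
  -- (ii) reduce modulo `𝔪_R`: in `κ[X]` the image of `Q` is `(X^a)` with `a ≤ 1`
  set π : R[X] →+* (ResidueField R)[X] := mapRingHom (residue R) with hπ
  have hπh : π h = X ^ h.natDegree := by rw [hπ, coe_mapRingHom, map_residue_eq_X_pow hmo hco]
  set J : Ideal (ResidueField R)[X] := Q.map π with hJ
  have hXmJ : (X : (ResidueField R)[X]) ^ h.natDegree ∈ J := hπh ▸ Ideal.mem_map_of_mem π hhQ
  obtain ⟨g, hg⟩ : ∃ g, J = Ideal.span {g} := ⟨_, (Ideal.span_singleton_generator J).symm⟩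
  have hgdvd : g ∣ X ^ h.natDegree := by rw [← Ideal.mem_span_singleton, ← hg]; exact hXmJ
  obtain ⟨a, ham, hga⟩ := (dvd_prime_pow prime_X _).mp hgdvd
  have hJa : J = Ideal.span {X ^ a} := by rw [hg]; exact Ideal.span_singleton_eq_span_singleton.mpr hga
  have hsXJ : π s' * X ^ h.natDegree ∈ J ^ h.natDegree := by
    rw [← hπh, ← map_mul, hJ, ← Ideal.map_pow]
    exact Ideal.mem_map_of_mem π hs'h
  rw [hJa, Ideal.span_singleton_pow, Ideal.mem_span_singleton, ← pow_mul] at hsXJ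
  have hXs : ¬ (X : (ResidueField R)[X]) ∣ π s' := by
    rw [X_dvd_iff, hπ, coe_mapRingHom, coeff_map, residue_eq_zero_iff]
    exact hs'0
  have ha1 : a ≤ 1 := by
    by_contra ha
    have hle : h.natDegree + 1 ≤ a * h.natDegree := by nlinarith
    have h1 : (X : (ResidueField R)[X]) ^ h.natDegree * X ∣ X ^ h.natDegree * π s' := by
      rw [← pow_succ, mul_comm (X ^ _) (π s')]
      exact (pow_dvd_pow X hle).trans hsXJ
    exact hXs ((mul_dvd_mul_iff_left (pow_ne_zero _ X_ne_zero)).mp h1)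
  have hXJ : (X : (ResidueField R)[X]) ∈ J := by
    rw [hJa, Ideal.mem_span_singleton]
    calc (X : (ResidueField R)[X]) ^ a ∣ X ^ 1 := pow_dvd_pow X ha1
      _ = X := pow_one X
  -- (iii) `X ∈ Q + 𝔪_R R[X]`
  have hπsurj : Function.Surjective π := map_surjective _ residue_surjective
  obtain ⟨g₁, hg₁Q, hg₁⟩ := (Ideal.mem_map_iff_of_surjective π hπsurj).mp hXJ
  have hXg₁ : X - g₁ ∈ (maximalIdeal R).map (C : R →+* R[X]) := by
    have h1 : X - g₁ ∈ RingHom.ker π := by rw [RingHom.mem_ker, map_sub, hg₁, hπ, coe_mapRingHom, map_X, sub_self]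
    rwa [hπ, ker_mapRingHom, ker_residue] at h1
  -- (iv) Nakayama for the finite `R`-module `D = R[X]/Q`
  set D := R[X] ⧸ Q with hD
  haveI : Module.Finite R (R[X] ⧸ Ideal.span {h}) := hmo.finite_adjoinRoot
  have hleQ : Ideal.span {h} ≤ Q := (Ideal.span_singleton_le_iff_mem _).mpr hhQ
  haveI : Module.Finite R D :=
    Module.Finite.of_surjective (Ideal.Quotient.factorₐ R hleQ).toLinearMap
      (Ideal.Quotient.factor_surjective hleQ)
  set N : Submodule R D := LinearMap.range (Algebra.linearMap R D) with hN
  have halg : ∀ r : R, algebraMap R D r = Ideal.Quotient.mk Q (C r) := fun r => rfl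
  have hgen : (⊤ : Submodule R D) ≤ N ⊔ maximalIdeal R • (⊤ : Submodule R D) := by
    rintro d -
    obtain ⟨g, rfl⟩ := Ideal.Quotient.mk_surjective d
    -- `g = C (g 0) + X·g'` and `X ∈ Q + 𝔪_R R[X]`
    have hsplit : Ideal.Quotient.mk Q g = algebraMap R D (g.coeff 0) + Ideal.Quotient.mk Q (X * g.divX) := by
      rw [halg, ← map_add, add_comm, X_mul_divX_add]
    rw [hsplit]
    refine Submodule.add_mem _ (Submodule.mem_sup_left ⟨g.coeff 0, rfl⟩) (Submodule.mem_sup_right ?_)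
    rw [Ideal.smul_top_eq_map, Submodule.restrictScalars_mem]
    have hX' : Ideal.Quotient.mk Q X ∈ (maximalIdeal R).map (algebraMap R D) := by
      have h2 : Ideal.Quotient.mk Q X = Ideal.Quotient.mk Q (X - g₁) := by
        rw [map_sub, Ideal.Quotient.eq_zero_iff_mem.mpr hg₁Q, sub_zero]
      rw [h2, show algebraMap R D = (Ideal.Quotient.mk Q).comp C from rfl, ← Ideal.map_map]
      exact Ideal.mem_map_of_mem _ hXg₁
    rw [map_mul]
    exact Ideal.mul_mem_right _ _ hX'
  have htop : (⊤ : Submodule R D) ≤ N :=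
    Submodule.le_of_le_smul_of_le_jacobson_bot Module.Finite.fg_top (IsLocalRing.maximalIdeal_le_jacobson ⊥) hgen
  obtain ⟨θ, hθ⟩ : Ideal.Quotient.mk Q X ∈ N := htop Submodule.mem_top
  refine ⟨θ, ?_, ?_⟩
  · -- `θ ∈ 𝔪_R`: `C θ ≡ X` modulo `Q ⊆ M` and `X ∈ M`
    have hCθ : C θ - X ∈ Q := by
      rw [← Ideal.Quotient.eq_zero_iff_mem, map_sub, sub_eq_zero, ← halg]; exact hθ
    have hCθM : C θ ∈ M := by
      have := M.add_mem (hQ hCθ) (Ideal.mem_sup_right (Ideal.mem_span_singleton_self X) : (X : R[X]) ∈ M)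
      rwa [sub_add_cancel] at this
    have h3 := Literature.AlgebraicGeometry.Resolution.Polynomial.coeff_zero_mem_of_mem_sup_span_X hCθM
    rwa [coeff_C_zero] at h3
  · rw [← Ideal.Quotient.eq_zero_iff_mem, map_sub, sub_eq_zero, ← halg]
    exact hθ.symm

end Order

/-! ## The read centre: `Q = (X − θ) + 𝔮·R[X]`, `R/𝔮 ≅ R[X]/Q` -/

section Split

variable {R : Type u} [CommRing R]

/-- If `X − θ ∈ Q` then `Q = (X − θ) + 𝔮·R[X]` with `𝔮 = Q ∩ R` (Euclidean division by `X − θ`). [folklore] -/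
theorem eq_span_X_sub_C_sup_of_mem {Q : Ideal R[X]} {θ : R} (hθ : X - C θ ∈ Q) :
    Q = Ideal.span {X - C θ} ⊔ (Q.comap (C : R →+* R[X])).map C := by
  refine le_antisymm (fun g hg => ?_) (sup_le ((Ideal.span_singleton_le_iff_mem _).mpr hθ) Ideal.map_comap_le)
  have hdiv : g %ₘ (X - C θ) + (X - C θ) * (g /ₘ (X - C θ)) = g := modByMonic_add_div g (X - C θ)
  rw [modByMonic_X_sub_C_eq_C_eval] at hdiv
  have hev : C (g.eval θ) ∈ (Q.comap (C : R →+* R[X])).map (C : R →+* R[X]) := by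
    refine Ideal.mem_map_of_mem _ (Ideal.mem_comap.mpr ?_)
    have : C (g.eval θ) = g - (X - C θ) * (g /ₘ (X - C θ)) := by linear_combination hdiv
    rw [this]
    exact Q.sub_mem hg (Q.mul_mem_right _ hθ)
  rw [← hdiv]
  exact Ideal.add_mem _ (Ideal.mem_sup_right hev) (Ideal.mem_sup_left (Ideal.mul_mem_right _ _ (Ideal.mem_span_singleton_self _)))

/-- If `X − θ ∈ Q` then `r ↦ r mod Q` induces `R/𝔮 ≅ R[X]/Q`, `𝔮 = Q ∩ R`. [folklore] -/
theorem exists_ringEquiv_quotient_comap_C_of_X_sub_C_mem (Q : Ideal R[X]) {θ : R} (hθ : X - C θ ∈ Q) :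
    ∃ e : R ⧸ Q.comap (C : R →+* R[X]) ≃+* R[X] ⧸ Q,
      ∀ r : R, e (Ideal.Quotient.mk _ r) = Ideal.Quotient.mk Q (C r) := by
  set f : R →+* R[X] ⧸ Q := (Ideal.Quotient.mk Q).comp C with hf
  have hker : RingHom.ker f = Q.comap (C : R →+* R[X]) := by
    ext r
    rw [RingHom.mem_ker, hf, RingHom.comp_apply, Ideal.Quotient.eq_zero_iff_mem, Ideal.mem_comap]
  have hsurj : Function.Surjective f := by
    intro d
    obtain ⟨g, rfl⟩ := Ideal.Quotient.mk_surjective d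
    refine ⟨g.eval θ, ?_⟩
    rw [hf, RingHom.comp_apply, Ideal.Quotient.eq, ← modByMonic_X_sub_C_eq_C_eval]
    have hdiv := modByMonic_add_div g (X - C θ)
    have : g %ₘ (X - C θ) - g = -((X - C θ) * (g /ₘ (X - C θ))) := by linear_combination hdiv
    rw [this]
    exact Q.neg_mem (Q.mul_mem_right _ hθ)
  refine ⟨(Ideal.quotEquivOfEq hker.symm).trans (RingHom.quotientKerEquivOfSurjective hsurj), fun r => ?_⟩
  rfl

end Split

section Adapted

variable {R : Type u} [CommRing R] [IsRegularLocalRing R] {h : R[X]}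

/-- [OURS · L1 W4.2] **D18 (i) ADAPT, algebraic core, packaged.** Under the hypotheses of `exists_X_sub_C_mem_of_order`: there are `θ ∈ 𝔪_R`
and a part `v : Fin c → R` of a regular system of parameters of `R` (`IsRsopPart v`) with `Q = (X − θ) + (v)·R[X]` — the centre, pulled back
to the frame ring, is `V(X − θ, v₁, …, v_c)`. [cite: CossartPiltant2019, Prop. 2.5–2.7 (arXiv v1 pp. 13–14)] [cite: Matsumura1987, Thm. 14.2] -/
theorem exists_adapted_prime_of_order (hmo : h.Monic) (hco : ∀ i < h.natDegree, h.coeff i ∈ maximalIdeal R)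
    (Q : Ideal R[X]) [Q.IsPrime] (hhQ : h ∈ Q) (hQ : Q ≤ (maximalIdeal R).map (C : R →+* R[X]) ⊔ Ideal.span {(X : R[X])})
    [IsRegularLocalRing (R[X] ⧸ Q)] (hord : ∃ s ∉ Q, s * h ∈ Q ^ h.natDegree) :
    ∃ θ ∈ maximalIdeal R, ∃ (c : ℕ) (v : Fin c → R), IsRsopPart v ∧
      Q = Ideal.span {X - C θ} ⊔ (Ideal.span (Set.range v)).map (C : R →+* R[X]) := by
  obtain ⟨θ, hθm, hθ⟩ := exists_X_sub_C_mem_of_order hmo hco Q hhQ hQ hord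
  obtain ⟨e, -⟩ := exists_ringEquiv_quotient_comap_C_of_X_sub_C_mem Q hθ
  haveI : IsRegularLocalRing (R ⧸ Q.comap (C : R →+* R[X])) := IsRegularLocalRing.of_ringEquiv e.symm
  have hle : Q.comap (C : R →+* R[X]) ≤ maximalIdeal R :=
    IsLocalRing.le_maximalIdeal (Ideal.comap_ne_top _ (Ideal.IsPrime.ne_top ‹_›))
  obtain ⟨c, v, hv, hspan⟩ := exists_isRsopPart_span_range_eq hle
  exact ⟨θ, hθm, c, v, hv, hspan ▸ eq_span_X_sub_C_sup_of_mem hθ⟩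

end Adapted

end Summit.ResolutionOfSingularities.ResolutionOfSingularities.Theorems.SigmaMaxModificationsCorridor3.Helpers

end
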